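import Mathlib
import Literature.NumberTheory.LFunctions.Zhang2022.Section17Eq177TailBounds
import Literature.NumberTheory.LFunctions.Zhang2022.Section15U009Tail
import HarnessLib

/-!
# Zhang (2022) §17 (17.7), the `Ψ₁ → Ψ` extension on `𝔍(−1)`: the TAIL part — moving the segment
# `𝔍(−1)` to `𝔍(−𝓛⁹)`, and its sum over `Ψ₂`

Topic `Literature/NumberTheory/LFunctions/Zhang2022` (Landau–Siegel audit tree; verdict-neutral).
Y. Zhang, *Discrete mean estimates and the Landau–Siegel zero*, arXiv:2211.02515v1 (2022)
[Zhang2022LandauSiegel] — **an unrefereed manuscript under adjudication; nothing here asserts or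
denies its Theorems 1–2.** ZHANG-L discharge lane (helper under node `Typed.Section17.Eq17_7`, the
(17.7) input of leaf `Typed.Section17.Eq17_9RelE`); THEOREM-ONLY.

§17 p. 97 (tex L4785): "… and then extend the sum over `Ψ₁` to the sum over `Ψ`". For `ψ ∈ Ψ₂ = Ψ ∖ Ψ₁`
the integrand `𝔨₃*(s,ψ)ω(s)` on `𝔍(−1)` is split (file `Section17Eq177TailBounds`) into the HEAD part
`(Σ_{n≤⌊P²⌋} ϱ*_≤(n)ψ̄(n)n^{−(1−s)})·BGNN(s)·ω(s)` (treated on `𝔍(0)` by a Hölder/large-sieve core,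
the tree's `Eq177.core177`) and the TAIL part `(Σ_{n>⌊P²⌋} …)·BGNN(s)·ω(s)`, holomorphic on `Re s < 0`.
This file is the §17 twin of the tree's `Typed.Section15A.U009.tail` ((7.3)/(14.3)/§15.u009 pattern,
§7 p. 35 "moving the segment to `𝔍(𝓛⁹)`"): Cauchy's theorem on the rectangle with vertical sides
`𝔍(−𝓛⁹)`, `𝔍(−1)` (`Section7aStatements.norm_intJ_sub_intJ_le`); on `1/2 − 𝓛⁹ ≤ σ ≤ −1/2` the
product tail·`BGNN` is `≤ S₄K_ι⌊P⌋⁶(⌊P²⌋+1)²·b^{1−σ}` with `b = ⌊P⌋/(⌊P²⌋+1) ≤ T⁻¹`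
(`norm_tail_BGNN_le`, `floorP_div_le_inv_bigT`), so the far segment carries `b^{𝓛⁹+1/2} ≤ e^{−𝓛¹⁰}`
against (7.4) (`eq74_holds`) and the horizontal sides carry `|ω| ≤ 2e^{1/4}e^{−𝓛¹⁰/4}`
(`U009.norm_omegaW_side_le_left`). Results:
* `tail177` — per `ψ ∈ Ψ` (no hypothesis on zeros): `‖∫_{𝔍(−1)} tail·BGNN·ω ds‖ ≤ C·e^{−𝓛¹⁰/16}`;
* `segInt_kfrak3Star_omega_sub_head_eq` — on `𝔍(−1)`, `(1/2πi)∫𝔨₃*ω − (1/2πi)∫head = (1/2πi)∫tail`;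
* `norm_segInt_kfrak3Star_omega_sub_head_le` — per `ψ`, `≤ C·e^{−𝓛¹⁰/16}`;
* `sum_PsiTwo_norm_segInt_kfrak3Star_sub_head_le` — the (T) half of the (17.7)-extension in the shape
  asked by the (17.7) assembler (`Σ_{ψ∈Ψ₂} ‖…‖ ≤ ε𝔓`, `#Ψ₂ ≤ 𝔓`).

## References

* Y. Zhang, arXiv:2211.02515v1 (2022), §17 (17.7) p. 97, tex L4785–L4789; §7 pp. 34–35, tex
  L1886–L1899; §2 (2.15). [cite: Zhang2022LandauSiegel, §17 (17.7) p. 97]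
-/

noncomputable section

open Complex Real MeasureTheory Set intervalIntegral
open scoped ComplexConjugate LSeries.notation

namespace Literature.NumberTheory.LFunctions.Zhang2022.Eq177

open Skeleton Typed.Section17 MeanSquareMajorant Section7aStatements Section7Eq73Edge
open Typed.Section15A.U009 (norm_omegaW_side_le_left)

variable (c' : ℝ) {D : ℕ}

/-! ### Real bookkeeping -/

/-- `b^{𝓛⁹+1/2} ≤ e^{−𝓛¹⁰}` for `0 ≤ b ≤ T⁻¹ = e^{−𝓛^{1.1}}`, `𝓛 ≥ 1`. [folklore] -/
private theorem base_pow_le' {D : ℕ} (hℓ : 1 ≤ ell D) {b : ℝ} (hb0 : 0 ≤ b) (hbT : b ≤ (bigT D)⁻¹) :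
    b ^ (ell D ^ 9 + 1 / 2) ≤ Real.exp (-ell D ^ 10) := by
  have hσ1 : 0 ≤ ell D ^ 9 + 1 / 2 := by positivity
  have h9 : 0 ≤ ell D ^ 9 := by positivity
  calc b ^ (ell D ^ 9 + 1 / 2) ≤ ((bigT D)⁻¹) ^ (ell D ^ 9 + 1 / 2) := Real.rpow_le_rpow hb0 hbT hσ1
    _ = Real.exp (-(ell D ^ (1.1 : ℝ)) * (ell D ^ 9 + 1 / 2)) := by
        rw [bigT, ← Real.exp_neg, Real.exp_mul]
    _ ≤ Real.exp (-ell D ^ 10) := by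
        apply Real.exp_le_exp.mpr
        have h11 : ell D ≤ ell D ^ (1.1 : ℝ) := by
          calc ell D = ell D ^ (1 : ℝ) := (Real.rpow_one _).symm
            _ ≤ ell D ^ (1.1 : ℝ) := Real.rpow_le_rpow_of_exponent_le hℓ (by norm_num)
        have h10 : ell D ^ 10 = ell D * ell D ^ 9 := by ring
        have hm : ell D * ell D ^ 9 ≤ ell D ^ (1.1 : ℝ) * (ell D ^ 9 + 1 / 2) :=
          mul_le_mul h11 (by linarith) h9 (le_trans (by linarith) h11)
        rw [h10]; linarith

/-- `⌊P⌋⁶(⌊P²⌋+1)² ≤ e^{2+10𝓛⁹}` (`P = e^{𝓛⁹}`, `𝓛 ≥ 1`). [folklore] -/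
private theorem floorP_pow_mul_sq_le {D : ℕ} (hℓ : 1 ≤ ell D) :
    (⌊bigP D⌋₊ : ℝ) ^ 6 * ((⌊bigP D ^ 2⌋₊ : ℝ) + 1) ^ 2 ≤ Real.exp (2 + 10 * ell D ^ 9) := by
  have hP0 : 0 < bigP D := Real.exp_pos _
  have h9 : 0 ≤ ell D ^ 9 := pow_nonneg (le_trans zero_le_one hℓ) 9
  have hN : (⌊bigP D⌋₊ : ℝ) ≤ bigP D := Nat.floor_le hP0.le
  have hN6 : (⌊bigP D⌋₊ : ℝ) ^ 6 ≤ Real.exp (6 * ell D ^ 9) := by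
    calc (⌊bigP D⌋₊ : ℝ) ^ 6 ≤ bigP D ^ 6 := pow_le_pow_left₀ (Nat.cast_nonneg _) hN 6
      _ = Real.exp (6 * ell D ^ 9) := by rw [bigP, ← Real.exp_nat_mul]; norm_num
  have hY : (⌊bigP D ^ 2⌋₊ : ℝ) + 1 ≤ Real.exp (1 + 2 * ell D ^ 9) := by
    have h1 : bigP D ^ 2 = Real.exp (2 * ell D ^ 9) := by rw [bigP, ← Real.exp_nat_mul]; norm_num
    have h0 : (⌊bigP D ^ 2⌋₊ : ℝ) ≤ bigP D ^ 2 := Nat.floor_le (by positivity)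
    rw [Real.exp_add]
    have h2 : (1 : ℝ) ≤ Real.exp (2 * ell D ^ 9) := Real.one_le_exp (by linarith)
    nlinarith [Real.add_one_le_exp (1 : ℝ), Real.exp_pos (2 * ell D ^ 9)]
  have hY2 : ((⌊bigP D ^ 2⌋₊ : ℝ) + 1) ^ 2 ≤ Real.exp (2 + 4 * ell D ^ 9) := by
    calc ((⌊bigP D ^ 2⌋₊ : ℝ) + 1) ^ 2 ≤ Real.exp (1 + 2 * ell D ^ 9) ^ 2 :=
          pow_le_pow_left₀ (by positivity) hY 2
      _ = Real.exp (2 + 4 * ell D ^ 9) := by rw [← Real.exp_nat_mul]; ring_nf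
  calc (⌊bigP D⌋₊ : ℝ) ^ 6 * ((⌊bigP D ^ 2⌋₊ : ℝ) + 1) ^ 2
      ≤ Real.exp (6 * ell D ^ 9) * Real.exp (2 + 4 * ell D ^ 9) :=
        mul_le_mul hN6 hY2 (by positivity) (Real.exp_pos _).le
    _ = Real.exp (2 + 10 * ell D ^ 9) := by rw [← Real.exp_add]; ring_nf

/-- Budget of the far segment: `⌊P⌋⁶(⌊P²⌋+1)²·e^{−𝓛¹⁰} ≤ e^{−𝓛¹⁰/16}` for `𝓛 ≥ 80`. [folklore] -/
private theorem budget_far' {D : ℕ} (hℓ : 80 ≤ ell D) :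
    (⌊bigP D⌋₊ : ℝ) ^ 6 * ((⌊bigP D ^ 2⌋₊ : ℝ) + 1) ^ 2 * Real.exp (-ell D ^ 10) ≤
      Real.exp (-(1 / 16) * ell D ^ 10) := by
  have hℓ1 : 1 ≤ ell D := le_trans (by norm_num) hℓ
  have h10 : ell D ^ 10 = ell D * ell D ^ 9 := by ring
  have h9 : 1 ≤ ell D ^ 9 := one_le_pow₀ hℓ1
  have hm : 80 * ell D ^ 9 ≤ ell D * ell D ^ 9 := mul_le_mul_of_nonneg_right hℓ (by linarith)
  calc (⌊bigP D⌋₊ : ℝ) ^ 6 * ((⌊bigP D ^ 2⌋₊ : ℝ) + 1) ^ 2 * Real.exp (-ell D ^ 10)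
      ≤ Real.exp (2 + 10 * ell D ^ 9) * Real.exp (-ell D ^ 10) :=
        mul_le_mul_of_nonneg_right (floorP_pow_mul_sq_le hℓ1) (Real.exp_pos _).le
    _ = Real.exp (2 + 10 * ell D ^ 9 - ell D ^ 10) := by rw [← Real.exp_add]; ring_nf
    _ ≤ Real.exp (-(1 / 16) * ell D ^ 10) := Real.exp_le_exp.mpr (by rw [h10]; linarith)

/-- Budget of the horizontal sides: `(𝓛⁹−1)·⌊P⌋⁶(⌊P²⌋+1)²·e^{−𝓛¹⁰/4} ≤ e^{−𝓛¹⁰/16}` for `𝓛 ≥ 80`.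
[folklore] -/
private theorem budget_sides' {D : ℕ} (hℓ : 80 ≤ ell D) :
    (ell D ^ 9 - 1) * ((⌊bigP D⌋₊ : ℝ) ^ 6 * ((⌊bigP D ^ 2⌋₊ : ℝ) + 1) ^ 2 *
        Real.exp (-(ell D ^ 10 / 4))) ≤ Real.exp (-(1 / 16) * ell D ^ 10) := by
  have hℓ1 : 1 ≤ ell D := le_trans (by norm_num) hℓ
  have h10 : ell D ^ 10 = ell D * ell D ^ 9 := by ring
  have h9 : 1 ≤ ell D ^ 9 := one_le_pow₀ hℓ1
  have hm : 80 * ell D ^ 9 ≤ ell D * ell D ^ 9 := mul_le_mul_of_nonneg_right hℓ (by linarith)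
  have hℓ9exp : ell D ^ 9 - 1 ≤ Real.exp (ell D ^ 9) := by linarith [Real.add_one_le_exp (ell D ^ 9)]
  have hQ0 : 0 ≤ (⌊bigP D⌋₊ : ℝ) ^ 6 * ((⌊bigP D ^ 2⌋₊ : ℝ) + 1) ^ 2 * Real.exp (-(ell D ^ 10 / 4)) :=
    by positivity
  calc (ell D ^ 9 - 1) * ((⌊bigP D⌋₊ : ℝ) ^ 6 * ((⌊bigP D ^ 2⌋₊ : ℝ) + 1) ^ 2 *
        Real.exp (-(ell D ^ 10 / 4)))
      ≤ Real.exp (ell D ^ 9) * (Real.exp (2 + 10 * ell D ^ 9) * Real.exp (-(ell D ^ 10 / 4))) :=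
        mul_le_mul hℓ9exp (mul_le_mul_of_nonneg_right (floorP_pow_mul_sq_le hℓ1) (Real.exp_pos _).le)
          hQ0 (Real.exp_pos _).le
    _ = Real.exp (2 + 11 * ell D ^ 9 - ell D ^ 10 / 4) := by
        rw [← Real.exp_add, ← Real.exp_add]; ring_nf
    _ ≤ Real.exp (-(1 / 16) * ell D ^ 10) := Real.exp_le_exp.mpr (by rw [h10]; linarith)

/-- `2πt₀ − 𝓛₁ > 0` for `𝓛 ≥ 1`. [folklore] -/
private theorem twoPiT0_sub_ell1_pos' {D : ℕ} (hℓ : 1 ≤ ell D) : 0 < 2 * π * t0 D - ell1 D := by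
  have h1 : ell D ^ 405 ≤ ell D ^ 519 := pow_le_pow_right₀ hℓ (by norm_num)
  have h2 : 1 ≤ ell D ^ 519 := one_le_pow₀ hℓ
  rw [t0, ell1]; nlinarith [Real.pi_gt_three]

/-- `|(1/2πi)∫_{𝔍(z)} F ds| ≤ ‖∫_{𝔍(z)} F ds‖` (`2π ≥ 1`; `∫_{𝔍(z)}` = `Section7aStatements.intJ`).
[cite: Zhang2022LandauSiegel, §7 p. 33 (definition of `𝔍(z)`)] -/
private theorem norm_segInt_le_norm_intJ' (D : ℕ) (z : ℝ) (F : ℂ → ℂ) :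
    ‖Lemma81.segInt (t0 D) (ell1 D) z F‖ ≤ ‖intJ D z F‖ := by
  have h : ‖intJ D z F‖ = 2 * π * ‖Lemma81.segInt (t0 D) (ell1 D) z F‖ := by
    rw [intJ, norm_mul, norm_mul, norm_mul, Complex.norm_I, Complex.norm_real, Complex.norm_ofNat,
      Real.norm_of_nonneg Real.pi_pos.le, mul_one]
  rw [h]
  have h1 : (1 : ℝ) ≤ 2 * π := by linarith [Real.pi_gt_three]
  nlinarith [norm_nonneg (Lemma81.segInt (t0 D) (ell1 D) z F)]

/-! ### The tail integrand and its holomorphy on `Re s < 0` -/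

/-- **The tail integrand `(Σ_{n>⌊P²⌋} ϱ*_≤ψ̄(n)n^{−(1−s)})·BGNN(s)·ω(s)` is holomorphic at every `s`
with `Re s < 0`** (the tail `LSeries` is holomorphic on `Re(1−s) > 1`; `B, G, N, ω` are entire).
[cite: Zhang2022LandauSiegel, §17 (17.7) p. 97; §7 p. 35, tex L1890] -/
theorem differentiableAt_tail177 [NeZero D] (χ : DirichletCharacter ℂ D) (x : Chr D) {s : ℂ}
    (hs : s.re < 0) :
    DifferentiableAt ℂ (fun s : ℂ =>
      LSeries (fun n : ℕ => if ⌊bigP D ^ 2⌋₊ < n then (trunc (D ^ 4) (nu χ) ⍟ kappa2bar c' D) n *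
          conj (x.ψ (n : ZMod x.p)) else 0) (1 - s) *
        (Bpoly χ x s * Gpoly χ x s * Nchar D (psiFn x) (s + beta2 c' D) *
          Nchar D (psiFn x) (s + beta3 c' D)) * omegaW D s) s := by
  have hopen : IsOpen {w : ℂ | 1 < w.re} := isOpen_lt continuous_const Complex.continuous_re
  have hw : (1 - s) ∈ {w : ℂ | 1 < w.re} := by
    simp only [Set.mem_setOf_eq, sub_re, one_re]; linarith
  have h2 : DifferentiableAt ℂ (fun s : ℂ =>
      LSeries (fun n : ℕ => if ⌊bigP D ^ 2⌋₊ < n then (trunc (D ^ 4) (nu χ) ⍟ kappa2bar c' D) n *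
          conj (x.ψ (n : ZMod x.p)) else 0) (1 - s)) s :=
    ((differentiableOn_LSeries_tauTwist_tail x (norm_varrhoLe_le_tau c' χ) ⌊bigP D ^ 2⌋₊).differentiableAt
      (hopen.mem_nhds hw)).comp s ((differentiableAt_const _).sub differentiableAt_id)
  have hB : DifferentiableAt ℂ (fun s : ℂ => Bpoly χ x s * Gpoly χ x s *
      Nchar D (psiFn x) (s + beta2 c' D) * Nchar D (psiFn x) (s + beta3 c' D)) s := by
    have h3 : Differentiable ℂ (fun z => Nchar D (psiFn x) (z + beta2 c' D)) :=
      (differentiable_Nchar (psiFn x)).comp (differentiable_id.add_const _)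
    have h4 : Differentiable ℂ (fun z => Nchar D (psiFn x) (z + beta3 c' D)) :=
      (differentiable_Nchar (psiFn x)).comp (differentiable_id.add_const _)
    exact ((((differentiable_Bpoly χ x).mul (differentiable_Gpoly χ x)).mul h3).mul h4) s
  exact (h2.mul hB).mul ((differentiable_omegaW D) s)

/-! ### The contour shift `𝔍(−1) → 𝔍(−𝓛⁹)` -/

/-- **The §17 twin of `Z22:§7.u017` / `U009.tail`** ("moving the segment to `𝔍(𝓛⁹)`", here to
`𝔍(−𝓛⁹)`): eventually in `D`, for every `ψ ∈ Ψ` (no hypothesis on the zeros of `L(s,ψ)`),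
`‖∫_{𝔍(−1)} (Σ_{n>⌊P²⌋} ϱ*_≤ψ̄(n)n^{−(1−s)})·B G N(s+β₂) N(s+β₃)·ω(s) ds‖ ≤ C·e^{−𝓛¹⁰/16}` with
`C = S₄K_ι(max(C₇₄,0) + 4e^{1/4})`. [cite: Zhang2022LandauSiegel, §17 (17.7) p. 97; §7 p. 35, tex L1890] -/
theorem tail177 (c' : ℝ) : ∃ C : ℝ, ForAllLarge fun D _ χ => ∀ x : Chr D,
    ‖intJ D (-1) (fun s : ℂ =>
      LSeries (fun n : ℕ => if ⌊bigP D ^ 2⌋₊ < n then (trunc (D ^ 4) (nu χ) ⍟ kappa2bar c' D) n *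
          conj (x.ψ (n : ZMod x.p)) else 0) (1 - s) *
        (Bpoly χ x s * Gpoly χ x s * Nchar D (psiFn x) (s + beta2 c' D) *
          Nchar D (psiFn x) (s + beta3 c' D)) * omegaW D s)‖ ≤
      C * Real.exp (-(1 / 16) * ell D ^ 10) := by
  obtain ⟨C₇₄, D₁, H74⟩ := eq74_holds
  obtain ⟨D₄, hD₄⟩ := exists_nat_forall_le_ell 80
  set S : ℝ := ∑' m : ℕ, tau 4 m * (m : ℝ) ^ (-(3 / 2 : ℝ)) with hSdef
  set K : ℝ := (1 + ‖iota2‖) * (‖iota3‖ + ‖iota4‖) with hKdef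
  have hS0 : 0 ≤ S := tsum_nonneg fun m => mul_nonneg (tau_nonneg 4 m)
    (Real.rpow_nonneg (Nat.cast_nonneg m) _)
  have hK0 : 0 ≤ K := by positivity
  set C' : ℝ := max C₇₄ 0 with hC'
  refine ⟨S * K * (C' + 4 * Real.exp (1 / 4)), max (max D₁ D₄) 3, fun D _ χ hD hq hp x => ?_⟩
  have hD1 : D₁ ≤ D := le_trans (le_trans (le_max_left _ _) (le_max_left _ _)) hD
  have hℓ80 : (80 : ℝ) ≤ ell D := hD₄ D (le_trans (le_trans (le_max_right _ _) (le_max_left _ _)) hD)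
  have hD3 : 3 ≤ D := le_trans (le_max_right _ _) hD
  have hℓ1 : 1 ≤ ell D := le_trans (by norm_num) hℓ80
  have hℓ4 : 4 ≤ ell D := le_trans (by norm_num) hℓ80
  have hℓ9 : 1 ≤ ell D ^ 9 := one_le_pow₀ hℓ1
  have hL0 : 0 ≤ ell1 D := by rw [ell1]; exact pow_nonneg (le_trans zero_le_one hℓ1) _
  have hside : 0 < 2 * π * t0 D - ell1 D := twoPiT0_sub_ell1_pos' hℓ1
  have hT1 : 1 ≤ bigT D := by rw [bigT]; exact Real.one_le_exp (by positivity)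
  -- the base
  set b : ℝ := (⌊bigP D⌋₊ : ℝ) / ((⌊bigP D ^ 2⌋₊ : ℝ) + 1) with hb
  have hbT : b ≤ (bigT D)⁻¹ := floorP_div_le_inv_bigT hℓ1
  have hb0 : 0 ≤ b := by
    rw [hb]
    exact div_nonneg (Nat.cast_nonneg _) (by linarith [(Nat.cast_nonneg ⌊bigP D ^ 2⌋₊ : (0 : ℝ) ≤ _)])
  have hb1 : b ≤ 1 := hbT.trans (inv_le_one_of_one_le₀ hT1)
  -- the integrand and its holomorphy
  set Lf : ℂ → ℂ := fun w =>
    LSeries (fun n : ℕ => if ⌊bigP D ^ 2⌋₊ < n then (trunc (D ^ 4) (nu χ) ⍟ kappa2bar c' D) n *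
      conj (x.ψ (n : ZMod x.p)) else 0) w with hLf
  set Q : ℂ → ℂ := fun s => Bpoly χ x s * Gpoly χ x s * Nchar D (psiFn x) (s + beta2 c' D) *
    Nchar D (psiFn x) (s + beta3 c' D) with hQ
  set F : ℂ → ℂ := fun s => Lf (1 - s) * Q s * omegaW D s with hF
  have hFat : ∀ s : ℂ, s.re < 0 → DifferentiableAt ℂ F s := fun s hre =>
    differentiableAt_tail177 c' χ x hre
  have hdiff : DifferentiableOn ℂ F (Set.uIcc (1 / 2 + (-ell D ^ 9 : ℝ)) (1 / 2 + (-1 : ℝ)) ×ℂ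
      Set.uIcc (2 * π * t0 D - ell1 D) (2 * π * t0 D + ell1 D)) := by
    intro s hs
    have h := Complex.mem_reProdIm.mp hs
    rw [Set.uIcc_of_le (by linarith), Set.uIcc_of_le (by linarith)] at h
    exact (hFat s (by linarith [h.1.2])).differentiableWithinAt
  -- the pointwise bound
  set G : ℝ := S * K * (⌊bigP D⌋₊ : ℝ) ^ 6 * ((⌊bigP D ^ 2⌋₊ : ℝ) + 1) ^ 2 with hG
  have hG0 : 0 ≤ G := by rw [hG]; positivity
  have hprod : ∀ s : ℂ, s.re ≤ -1 / 2 → ‖Lf (1 - s) * Q s‖ ≤ G * b ^ (1 - s).re := by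
    intro s hs
    have h := norm_tail_BGNN_le c' χ hD3 hℓ4 x hs
    simp only [hLf, hQ, hG, hb]
    calc _ ≤ _ := h
      _ = _ := by ring
  -- Step 1: the segment `𝔍(−𝓛⁹)`
  have hbpow : b ^ (ell D ^ 9 + 1 / 2) ≤ Real.exp (-ell D ^ 10) := base_pow_le' hℓ1 hb0 hbT
  have hre : ∀ v : ℝ, (((-ell D ^ 9 : ℝ) : ℂ) + s0 D + v * I).re = -ell D ^ 9 + 1 / 2 := by
    intro v; simp [s0, SmoothWeight.s0, -Complex.ofReal_pow]
  have hfar : ‖intJ D (-ell D ^ 9) F‖ ≤ G * Real.exp (-ell D ^ 10) * C' := by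
    refine (norm_intJ_le_absIntJ D hL0 _ F).trans ?_
    have hpt := continuous_segPoint (D := D) (-ell D ^ 9)
    have hFc : ContinuousOn (fun v : ℝ => F (((-ell D ^ 9 : ℝ) : ℂ) + s0 D + v * I))
        (Set.uIcc (-ell1 D) (ell1 D)) := by
      intro v _
      have h1 : DifferentiableAt ℂ F (((-ell D ^ 9 : ℝ) : ℂ) + s0 D + v * I) :=
        hFat _ (by rw [hre]; linarith)
      exact (ContinuousAt.comp (f := fun v : ℝ => ((-ell D ^ 9 : ℝ) : ℂ) + s0 D + v * I)
        h1.continuousAt hpt.continuousAt).continuousWithinAt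
    have hωc : Continuous fun v : ℝ => ‖omegaW D (((-ell D ^ 9 : ℝ) : ℂ) + s0 D + v * I)‖ :=
      (continuous_omegaW_seg (D := D) (-ell D ^ 9)).norm
    have hptw : ∀ v ∈ Set.Icc (-ell1 D) (ell1 D),
        ‖F (((-ell D ^ 9 : ℝ) : ℂ) + s0 D + v * I)‖ ≤
          G * Real.exp (-ell D ^ 10) * ‖omegaW D (((-ell D ^ 9 : ℝ) : ℂ) + s0 D + v * I)‖ := by
      intro v _
      have h := hprod (((-ell D ^ 9 : ℝ) : ℂ) + s0 D + v * I) (by rw [hre]; linarith)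
      have hure : (1 - (((-ell D ^ 9 : ℝ) : ℂ) + s0 D + v * I)).re = ell D ^ 9 + 1 / 2 := by
        rw [sub_re, one_re, hre]; ring
      rw [hure] at h
      show ‖Lf (1 - _) * Q _ * omegaW D _‖ ≤ _
      rw [norm_mul]
      exact mul_le_mul_of_nonneg_right (h.trans (mul_le_mul_of_nonneg_left hbpow hG0)) (norm_nonneg _)
    have hGe : 0 ≤ G * Real.exp (-ell D ^ 10) := mul_nonneg hG0 (Real.exp_pos _).le
    calc absIntJ D (-ell D ^ 9) F
        = ∫ v in (-ell1 D)..ell1 D, ‖F (((-ell D ^ 9 : ℝ) : ℂ) + s0 D + v * I)‖ := rfl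
      _ ≤ ∫ v in (-ell1 D)..ell1 D,
            G * Real.exp (-ell D ^ 10) * ‖omegaW D (((-ell D ^ 9 : ℝ) : ℂ) + s0 D + v * I)‖ :=
          intervalIntegral.integral_mono_on (by linarith) (hFc.norm.intervalIntegrable)
            ((continuous_const.mul hωc).intervalIntegrable _ _) hptw
      _ = G * Real.exp (-ell D ^ 10) * absIntJ D (-ell D ^ 9) (omegaW D) := by
          rw [intervalIntegral.integral_const_mul]; rfl
      _ ≤ G * Real.exp (-ell D ^ 10) * C' :=
          mul_le_mul_of_nonneg_left ((H74 D χ hD1 hq hp (-ell D ^ 9) (by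
            rw [abs_neg, abs_of_nonneg (le_trans zero_le_one hℓ9)])).trans (le_max_left _ _)) hGe
  -- Step 2: the horizontal sides
  set Mh : ℝ := G * (2 * Real.exp (1 / 4) * Real.exp (-(ell D ^ 10 / 4))) with hMh
  have hM : ∀ u ∈ Set.Icc (1 / 2 + (-ell D ^ 9 : ℝ)) (1 / 2 + (-1 : ℝ)), ∀ v : ℝ, v ^ 2 = ell1 D ^ 2 →
      ‖F ((u : ℂ) + ((2 * π * t0 D + v : ℝ) : ℂ) * I)‖ ≤ Mh := by
    intro u hu v hv
    have hu0 : 1 / 2 - ell D ^ 9 ≤ u := by linarith [hu.1]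
    have hu1 : u ≤ -1 / 2 := by linarith [hu.2]
    have hsre : ((u : ℂ) + ((2 * π * t0 D + v : ℝ) : ℂ) * I).re = u := by simp
    have h := hprod ((u : ℂ) + ((2 * π * t0 D + v : ℝ) : ℂ) * I) (by rw [hsre]; exact hu1)
    have hure : (1 - ((u : ℂ) + ((2 * π * t0 D + v : ℝ) : ℂ) * I)).re = 1 - u := by
      rw [sub_re, one_re, hsre]
    rw [hure] at h
    have hbu : b ^ (1 - u) ≤ 1 := Real.rpow_le_one hb0 hb1 (by linarith)
    have hω : ‖omegaW D ((u : ℂ) + ((2 * π * t0 D + v : ℝ) : ℂ) * I)‖ ≤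
        2 * Real.exp (1 / 4) * Real.exp (-(ell D ^ 10 / 4)) :=
      norm_omegaW_side_le_left hD3 hu0 (by linarith) hv
    show ‖Lf (1 - _) * Q _ * omegaW D _‖ ≤ Mh
    rw [norm_mul, hMh]
    refine mul_le_mul (h.trans ?_) hω (norm_nonneg _) hG0
    calc G * b ^ (1 - u) ≤ G * 1 := mul_le_mul_of_nonneg_left hbu hG0
      _ = G := mul_one _
  have hshift : ‖intJ D (-1) F - intJ D (-ell D ^ 9) F‖ ≤ ((-1 : ℝ) - (-ell D ^ 9)) * (Mh + Mh) := by
    refine norm_intJ_sub_intJ_le D (by linarith) hdiff (fun u hu => hM u hu _ rfl) fun u hu => ?_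
    have e : (2 * π * t0 D - ell1 D : ℝ) = 2 * π * t0 D + -ell1 D := by ring
    rw [e]
    exact hM u hu _ (by ring)
  -- Step 3: assemble with the budgets
  have hSK : 0 ≤ S * K := mul_nonneg hS0 hK0
  have hbud1 := budget_far' hℓ80
  have hbud2 := budget_sides' hℓ80
  calc ‖intJ D (-1) F‖ = ‖intJ D (-ell D ^ 9) F + (intJ D (-1) F - intJ D (-ell D ^ 9) F)‖ := by
        rw [add_sub_cancel]
    _ ≤ ‖intJ D (-ell D ^ 9) F‖ + ‖intJ D (-1) F - intJ D (-ell D ^ 9) F‖ := norm_add_le _ _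
    _ ≤ G * Real.exp (-ell D ^ 10) * C' + ((-1 : ℝ) - (-ell D ^ 9)) * (Mh + Mh) := add_le_add hfar hshift
    _ = C' * (G * Real.exp (-ell D ^ 10)) +
          4 * Real.exp (1 / 4) * ((ell D ^ 9 - 1) * (G * Real.exp (-(ell D ^ 10 / 4)))) := by
        rw [hMh]; ring
    _ = S * K * C' * ((⌊bigP D⌋₊ : ℝ) ^ 6 * ((⌊bigP D ^ 2⌋₊ : ℝ) + 1) ^ 2 * Real.exp (-ell D ^ 10)) +
          S * K * (4 * Real.exp (1 / 4)) * ((ell D ^ 9 - 1) *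
            ((⌊bigP D⌋₊ : ℝ) ^ 6 * ((⌊bigP D ^ 2⌋₊ : ℝ) + 1) ^ 2 * Real.exp (-(ell D ^ 10 / 4)))) := by
        rw [hG]; ring
    _ ≤ S * K * C' * Real.exp (-(1 / 16) * ell D ^ 10) +
          S * K * (4 * Real.exp (1 / 4)) * Real.exp (-(1 / 16) * ell D ^ 10) :=
        add_le_add (mul_le_mul_of_nonneg_left hbud1 (mul_nonneg hSK (le_max_right _ _)))
          (mul_le_mul_of_nonneg_left hbud2 (mul_nonneg hSK (by positivity)))
    _ = S * K * (C' + 4 * Real.exp (1 / 4)) * Real.exp (-(1 / 16) * ell D ^ 10) := by ring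

/-! ### On `𝔍(−1)`: `(1/2πi)∫𝔨₃*ω − (1/2πi)∫head = (1/2πi)∫tail` -/

/-- **Splitting the `𝔍(−1)`-integral of `𝔨₃*(s,ψ)ω(s)`** (`D ≥ 1`): on `𝔍(−1)` (`Re s = −1/2 < 0`) the
integrand is head + tail pointwise (`kfrak3Star_mul_omega_sub_head_eq`), both continuous along the
segment, so `(1/2πi)∫_{𝔍(−1)}𝔨₃*ω − (1/2πi)∫_{𝔍(−1)}head = (1/2πi)∫_{𝔍(−1)}tail`.
[cite: Zhang2022LandauSiegel, §17 (17.7) p. 97; §7 p. 34, tex L1877] -/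
theorem segInt_kfrak3Star_omega_sub_head_eq [NeZero D] (χ : DirichletCharacter ℂ D) (x : Chr D) :
    Lemma81.segInt (t0 D) (ell1 D) (-1) (fun s => kfrak3Star c' χ x s * omegaW D s) -
        Lemma81.segInt (t0 D) (ell1 D) (-1) (fun s =>
          (∑ n ∈ Finset.Icc 1 ⌊bigP D ^ 2⌋₊, (trunc (D ^ 4) (nu χ) ⍟ kappa2bar c' D) n *
              conj (x.ψ (n : ZMod x.p)) * (n : ℂ) ^ (-(1 - s))) *
            (Bpoly χ x s * Gpoly χ x s * Nchar D (psiFn x) (s + beta2 c' D) *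
              Nchar D (psiFn x) (s + beta3 c' D)) * omegaW D s) =
      Lemma81.segInt (t0 D) (ell1 D) (-1) (fun s =>
        LSeries (fun n : ℕ => if ⌊bigP D ^ 2⌋₊ < n then (trunc (D ^ 4) (nu χ) ⍟ kappa2bar c' D) n *
            conj (x.ψ (n : ZMod x.p)) else 0) (1 - s) *
          (Bpoly χ x s * Gpoly χ x s * Nchar D (psiFn x) (s + beta2 c' D) *
            Nchar D (psiFn x) (s + beta3 c' D)) * omegaW D s) := by
  set X : ℕ := ⌊bigP D ^ 2⌋₊ with hX
  set Hd : ℂ → ℂ := fun s =>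
    (∑ n ∈ Finset.Icc 1 X, (trunc (D ^ 4) (nu χ) ⍟ kappa2bar c' D) n *
        conj (x.ψ (n : ZMod x.p)) * (n : ℂ) ^ (-(1 - s))) *
      (Bpoly χ x s * Gpoly χ x s * Nchar D (psiFn x) (s + beta2 c' D) *
        Nchar D (psiFn x) (s + beta3 c' D)) * omegaW D s with hHd
  set Tl : ℂ → ℂ := fun s =>
    LSeries (fun n : ℕ => if X < n then (trunc (D ^ 4) (nu χ) ⍟ kappa2bar c' D) n *
        conj (x.ψ (n : ZMod x.p)) else 0) (1 - s) *
      (Bpoly χ x s * Gpoly χ x s * Nchar D (psiFn x) (s + beta2 c' D) *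
        Nchar D (psiFn x) (s + beta3 c' D)) * omegaW D s with hTl
  -- the path and its real part
  have hz : ((-1 : ℝ) : ℂ) = -1 := by push_cast; ring
  have hpt_re : ∀ v : ℝ, ((-1 : ℂ) + SmoothWeight.s0 (t0 D) + v * I).re = -1 / 2 := by
    intro v; simp [SmoothWeight.s0]; norm_num
  have hptc : Continuous fun v : ℝ => (-1 : ℂ) + SmoothWeight.s0 (t0 D) + v * I := by fun_prop
  -- pointwise splitting on the path
  have hsplit_pt : ∀ v : ℝ,
      kfrak3Star c' χ x ((-1 : ℂ) + SmoothWeight.s0 (t0 D) + v * I) *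
          omegaW D ((-1 : ℂ) + SmoothWeight.s0 (t0 D) + v * I) =
        Hd ((-1 : ℂ) + SmoothWeight.s0 (t0 D) + v * I) + Tl ((-1 : ℂ) + SmoothWeight.s0 (t0 D) + v * I) := by
    intro v
    have hs : ((-1 : ℂ) + SmoothWeight.s0 (t0 D) + v * I).re < 0 := by rw [hpt_re]; norm_num
    have h := kfrak3Star_mul_omega_sub_head_eq c' χ x X hs
    simp only [hHd, hTl]
    rw [← h]; ring
  -- continuity of the two pieces along the path
  have hHdD : Differentiable ℂ Hd := by
    have h2 : Differentiable ℂ (fun s : ℂ => ∑ n ∈ Finset.Icc 1 X,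
        (trunc (D ^ 4) (nu χ) ⍟ kappa2bar c' D) n * conj (x.ψ (n : ZMod x.p)) * (n : ℂ) ^ (-(1 - s))) :=
      (differentiable_tauTwist_head x (a := trunc (D ^ 4) (nu χ) ⍟ kappa2bar c' D) X).comp
        ((differentiable_const _).sub differentiable_id)
    have h3 : Differentiable ℂ (fun z => Nchar D (psiFn x) (z + beta2 c' D)) :=
      (differentiable_Nchar (psiFn x)).comp (differentiable_id.add_const _)
    have h4 : Differentiable ℂ (fun z => Nchar D (psiFn x) (z + beta3 c' D)) :=
      (differentiable_Nchar (psiFn x)).comp (differentiable_id.add_const _)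
    exact (h2.mul ((((differentiable_Bpoly χ x).mul (differentiable_Gpoly χ x)).mul h3).mul h4)).mul
      (differentiable_omegaW D)
  have hint_Hd : IntervalIntegrable (fun v : ℝ => Hd ((-1 : ℂ) + SmoothWeight.s0 (t0 D) + v * I))
      volume (-ell1 D) (ell1 D) :=
    (hHdD.continuous.comp hptc).intervalIntegrable _ _
  have hint_Tl : IntervalIntegrable (fun v : ℝ => Tl ((-1 : ℂ) + SmoothWeight.s0 (t0 D) + v * I))
      volume (-ell1 D) (ell1 D) := by
    refine ContinuousOn.intervalIntegrable fun v _ => ?_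
    have h1 : DifferentiableAt ℂ Tl ((-1 : ℂ) + SmoothWeight.s0 (t0 D) + v * I) :=
      differentiableAt_tail177 c' χ x (by rw [hpt_re]; norm_num)
    exact (ContinuousAt.comp (f := fun v : ℝ => (-1 : ℂ) + SmoothWeight.s0 (t0 D) + v * I)
      h1.continuousAt hptc.continuousAt).continuousWithinAt
  have e1 : (∫ v in (-ell1 D)..ell1 D, kfrak3Star c' χ x ((-1 : ℂ) + SmoothWeight.s0 (t0 D) + v * I) *
        omegaW D ((-1 : ℂ) + SmoothWeight.s0 (t0 D) + v * I)) =
      ∫ v in (-ell1 D)..ell1 D, (Hd ((-1 : ℂ) + SmoothWeight.s0 (t0 D) + v * I) +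
        Tl ((-1 : ℂ) + SmoothWeight.s0 (t0 D) + v * I)) :=
    intervalIntegral.integral_congr fun v _ => hsplit_pt v
  show (1 / (2 * π) : ℂ) * (∫ v in (-ell1 D)..ell1 D,
        kfrak3Star c' χ x ((-1 : ℂ) + SmoothWeight.s0 (t0 D) + v * I) *
          omegaW D ((-1 : ℂ) + SmoothWeight.s0 (t0 D) + v * I)) -
      (1 / (2 * π) : ℂ) * (∫ v in (-ell1 D)..ell1 D, Hd ((-1 : ℂ) + SmoothWeight.s0 (t0 D) + v * I)) =
      (1 / (2 * π) : ℂ) * ∫ v in (-ell1 D)..ell1 D, Tl ((-1 : ℂ) + SmoothWeight.s0 (t0 D) + v * I)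
  rw [e1, intervalIntegral.integral_add hint_Hd hint_Tl]
  ring

/-- **Per character, the head-subtracted `𝔍(−1)`-integral of `𝔨₃*ω` is exponentially small**:
eventually in `D`, for every `ψ ∈ Ψ`,
`‖(1/2πi)∫_{𝔍(−1)}𝔨₃*(s,ψ)ω(s)ds − (1/2πi)∫_{𝔍(−1)}head ds‖ ≤ C·e^{−𝓛¹⁰/16}`.
[cite: Zhang2022LandauSiegel, §17 (17.7) p. 97; §7 p. 35, tex L1890] -/
theorem norm_segInt_kfrak3Star_omega_sub_head_le (c' : ℝ) : ∃ C : ℝ, ForAllLarge fun D _ χ =>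
    ∀ x : Chr D,
      ‖Lemma81.segInt (t0 D) (ell1 D) (-1) (fun s => kfrak3Star c' χ x s * omegaW D s) -
          Lemma81.segInt (t0 D) (ell1 D) (-1) (fun s =>
            (∑ n ∈ Finset.Icc 1 ⌊bigP D ^ 2⌋₊, (trunc (D ^ 4) (nu χ) ⍟ kappa2bar c' D) n *
                conj (x.ψ (n : ZMod x.p)) * (n : ℂ) ^ (-(1 - s))) *
              (Bpoly χ x s * Gpoly χ x s * Nchar D (psiFn x) (s + beta2 c' D) *
                Nchar D (psiFn x) (s + beta3 c' D)) * omegaW D s)‖ ≤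
        C * Real.exp (-(1 / 16) * ell D ^ 10) := by
  obtain ⟨C, D₁, H⟩ := tail177 c'
  refine ⟨C, D₁, fun D _ χ hD hq hp x => ?_⟩
  have hz : ((-1 : ℝ) : ℂ) = -1 := by push_cast; ring
  rw [segInt_kfrak3Star_omega_sub_head_eq c' χ x, ← hz]
  exact (norm_segInt_le_norm_intJ' D (-1) _).trans (H D χ hD hq hp x)

/-- **The (17.7)-extension, TAIL half on `Ψ₂ = Ψ ∖ Ψ₁`** (§17 p. 97, tex L4785: "… and then extend the
sum over `Ψ₁` to the sum over `Ψ`"; the §17 twin of the tail part of (7.3)/§15.u009): for every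
`ε > 0`, all large `D`, all real primitive `χ (mod D)` under (A),
`Σ_{ψ∈Ψ₂} ‖(1/2πi)∫_{𝔍(−1)}𝔨₃*(s,ψ)ω(s)ds − (1/2πi)∫_{𝔍(−1)}(Σ_{n≤⌊P²⌋}ϱ*_≤ψ̄(n)n^{−(1−s)})BGNN(s)ω(s)ds‖
≤ ε𝔓` (per `ψ` the difference is `≤ Ce^{−𝓛¹⁰/16}`, and `#Ψ₂ ≤ 𝔓`). ((A) is not used.)
[cite: Zhang2022LandauSiegel, §17 (17.7) p. 97, tex L4785; §7 (7.3) p. 34] -/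
theorem sum_PsiTwo_norm_segInt_kfrak3Star_sub_head_le (c' : ℝ) :
    ∀ ε : ℝ, 0 < ε → ForAllLarge fun D _ χ => AssumptionA D χ →
      ∑ x ∈ finsetOf (PsiTwo χ),
        ‖Lemma81.segInt (t0 D) (ell1 D) (-1) (fun s => kfrak3Star c' χ x s * omegaW D s) -
            Lemma81.segInt (t0 D) (ell1 D) (-1) (fun s =>
              (∑ n ∈ Finset.Icc 1 ⌊bigP D ^ 2⌋₊,
                  (LSeries.convolution (trunc (D ^ 4) (nu χ)) (kappa2bar c' D)) n *
                    conj (x.ψ (n : ZMod x.p)) * (n : ℂ) ^ (-(1 - s))) *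
                (Bpoly χ x s * Gpoly χ x s * Nchar D (psiFn x) (s + beta2 c' D) *
                  Nchar D (psiFn x) (s + beta3 c' D)) * omegaW D s)‖ ≤ ε * frakP D := by
  intro ε hε
  obtain ⟨C, D₁, H⟩ := norm_segInt_kfrak3Star_omega_sub_head_le c'
  set C' : ℝ := max C 0 with hC'
  set M : ℝ := max 2 (16 * C' / ε + 1) with hMdef
  obtain ⟨D₅, H5⟩ := exists_nat_forall_le_ell M
  refine ⟨max D₁ D₅, fun D _ χ hD hq hp _ => ?_⟩
  have hD1 : D₁ ≤ D := le_trans (le_max_left _ _) hD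
  have hD5 : D₅ ≤ D := le_trans (le_max_right _ _) hD
  have hM := H5 D hD5
  have hℓ2 : 2 ≤ ell D := le_trans (le_max_left _ _) hM
  have hℓ0 : 0 < ell D := by linarith
  set e : ℝ := Real.exp (-(1 / 16) * ell D ^ 10) with hedef
  have he : 0 < e := Real.exp_pos _
  have hfrakP : 0 ≤ frakP D := le_trans (Nat.cast_nonneg _) (card_finsetOf_PsiTwo_le_frakP χ)
  have hper : ∀ x : Chr D, ‖Lemma81.segInt (t0 D) (ell1 D) (-1) (fun s => kfrak3Star c' χ x s * omegaW D s) -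
      Lemma81.segInt (t0 D) (ell1 D) (-1) (fun s =>
        (∑ n ∈ Finset.Icc 1 ⌊bigP D ^ 2⌋₊,
            (LSeries.convolution (trunc (D ^ 4) (nu χ)) (kappa2bar c' D)) n *
              conj (x.ψ (n : ZMod x.p)) * (n : ℂ) ^ (-(1 - s))) *
          (Bpoly χ x s * Gpoly χ x s * Nchar D (psiFn x) (s + beta2 c' D) *
            Nchar D (psiFn x) (s + beta3 c' D)) * omegaW D s)‖ ≤ C' * e :=
    fun x => (H D χ hD1 hq hp x).trans (mul_le_mul_of_nonneg_right (le_max_left _ _) he.le)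
  -- smallness: `C'·e ≤ ε` for `𝓛 ≥ M` (`e ≤ e^{−𝓛} ≤ 1/𝓛`... we use `e^{−𝓛¹⁰/16} ≤ e^{−𝓛/16} ≤ 16/𝓛`)
  have hsmall : C' * e ≤ ε := by
    have hC'0 : 0 ≤ C' := le_max_right _ _
    have h1 : 16 * C' / ε + 1 ≤ ell D := le_trans (le_max_right _ _) hM
    have h2 : 16 * C' < ε * ell D := by
      have := (div_le_iff₀ hε).mp (by linarith : 16 * C' / ε ≤ ell D - 1)
      nlinarith
    have he1 : e ≤ Real.exp (-(ell D / 16)) := by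
      rw [hedef]
      apply Real.exp_le_exp.mpr
      have h10 : ell D ≤ ell D ^ 10 := le_self_pow₀ (by linarith) (by norm_num)
      linarith
    have he2 : Real.exp (-(ell D / 16)) ≤ 16 / ell D := by
      have h := Real.add_one_le_exp (ell D / 16)
      rw [Real.exp_neg, inv_eq_one_div, div_le_div_iff₀ (Real.exp_pos _) hℓ0]
      nlinarith
    calc C' * e ≤ C' * (16 / ell D) := mul_le_mul_of_nonneg_left (he1.trans he2) hC'0
      _ = 16 * C' / ell D := by ring
      _ ≤ ε := by rw [div_le_iff₀ hℓ0]; linarith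
  calc ∑ x ∈ finsetOf (PsiTwo χ), ‖Lemma81.segInt (t0 D) (ell1 D) (-1)
          (fun s => kfrak3Star c' χ x s * omegaW D s) -
        Lemma81.segInt (t0 D) (ell1 D) (-1) (fun s =>
          (∑ n ∈ Finset.Icc 1 ⌊bigP D ^ 2⌋₊,
              (LSeries.convolution (trunc (D ^ 4) (nu χ)) (kappa2bar c' D)) n *
                conj (x.ψ (n : ZMod x.p)) * (n : ℂ) ^ (-(1 - s))) *
            (Bpoly χ x s * Gpoly χ x s * Nchar D (psiFn x) (s + beta2 c' D) *
              Nchar D (psiFn x) (s + beta3 c' D)) * omegaW D s)‖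
      ≤ ∑ x ∈ finsetOf (PsiTwo χ), C' * e := Finset.sum_le_sum fun x _ => hper x
    _ = ((finsetOf (PsiTwo χ)).card : ℝ) * (C' * e) := by rw [Finset.sum_const, nsmul_eq_mul]
    _ ≤ frakP D * ε :=
        mul_le_mul (card_finsetOf_PsiTwo_le_frakP χ) hsmall (by positivity) hfrakP
    _ = ε * frakP D := mul_comm _ _

end Literature.NumberTheory.LFunctions.Zhang2022.Eq177
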